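import Summits.ValiantsHypothesis.ValiantsHypothesis.Theorems.LacunarySymmetroidMatrixDescartesCensusTwistedRolle
import Summits.ValiantsHypothesis.ValiantsHypothesis.Theorems.LacunarySymmetroidMatrixDescartesCensusTetranomialStaircase

/-!
# `MatrixDescartes` census — T4 rows in PRODUCT FORM: the four-term window of a Descartes-sharp fewnomial and the coefficient staircase

HONEST FRAMING.  Object-search cell `pub-symmetroid`; door-A item `Theses.LacunarySymmetroid.DoorA26 = PosRootLawAt 2 6 19`
(stmt-ValiantsHypothesis-19979; OPEN, typed, never asserted).  Companion of `…CensusTetranomialStaircase` (the T4 STAIRCASE LEMMA,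
`Census.T4.tetranomial_upper_staircase_of_card`).  This file puts a T4 row in the SAME currency as the kernel's C25 `newton_cone`
(product form, natural exponents, the fewnomial's own `|cₜ|` and gap products), so that a census node file can consume it exactly like a
C25 row:

* `tetranomial_window_card` — if `f = ∑_{t<n} cₜ X^{eₜ}` (`e` strictly increasing) has `≥ n − 1` distinct positive roots, then for
  indices `p < q < r < s` the four-term window `∑_{t ∈ {p,q,r,s}} cₜ·(∏_{u ∉ {p,q,r,s}} (eₜ − e_u))·X^{eₜ}` has `≥ 3` distinct positive roots
  (`card_posRoots_le_card_posRoots_twists` with the `n − 4` outside exponents killed);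
* `tetranomial_upper_staircase_coeff` — PRODUCT FORM of the upper staircase: if `A_p X^i − A_q X^{i+a} + A_r X^{i+b} − A_s X^{i+c}`
  (`A` positive, `0 < a < b < c`) has `≥ 3` distinct positive roots, `(β′, γ′, ξ)` is a rational upper-branch double-root point and
  `A_r^c ≤ γ′^c · A_p^{c−b} · A_s^b` (the window's `γ ≤ γ′`), then `A_q^c ≤ β′^c · A_p^{c−a} · A_s^a` (its `β ≤ β′`) — the normalisation
  `x = λy`, `λ^c = A_p/A_s` is done once here (one `Real.rpow`), consumers see natural powers only.

A replay instantiates `tetranomial_window_card` at a window of four consecutive positions of the 21-term twenty (the outside gap products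
then have a common sign, which is moved into the `A`'s), and `tetranomial_upper_staircase_coeff` (or its mirror through
`tetranomial_reverse_card`) with the rational certificate of the slab.  Nothing here bears on `DoorA26`, on `MatrixDescartes` (18050) or
on `VP ≠ VNP`.

[folklore] Iterated Euler twists (Rolle) and a scaling; elementary.
-/

-- `Summit.ValiantsHypothesis.ValiantsHypothesis.…` repeats a component by the D-0017 layout
-- (single-conjunct summit), which the `dupNamespace` linter flags; the name is mandated.
set_option linter.dupNamespace false

namespace Summit.ValiantsHypothesis.ValiantsHypothesis.Theorems.LacunarySymmetroidMatrixDescartes.Census.T4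

open Polynomial Finset
open scoped BigOperators Polynomial
open Summit.ValiantsHypothesis.ValiantsHypothesis.Theorems.LacunarySymmetroidMatrixDescartes.Census

/-! ## The four-term window of a Descartes-sharp fewnomial -/

/-- **Window reduction (k = 4).**  A Descartes-sharp fewnomial (`n` monomials, `≥ n − 1` distinct positive roots) leaves on any four
indices `p < q < r < s`, after the `n − 4` Euler twists killing the other exponents, a four-term polynomial with `≥ 3` distinct positive
roots. [folklore] -/
theorem tetranomial_window_card {n : ℕ} (e : Fin n → ℕ) (c : Fin n → ℝ)
    (hZ : n ≤ ((∑ t, C (c t) * X ^ (e t)).roots.toFinset.filter (fun x => 0 < x)).card + 1)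
    {p q r s : Fin n} (hpq : p < q) (hqr : q < r) (hrs : r < s) :
    3 ≤ ((C (c p * ∏ u ∈ (((univ.erase p).erase q).erase r).erase s, ((e p : ℝ) - e u)) * X ^ (e p)
        + C (c q * ∏ u ∈ (((univ.erase p).erase q).erase r).erase s, ((e q : ℝ) - e u)) * X ^ (e q)
        + C (c r * ∏ u ∈ (((univ.erase p).erase q).erase r).erase s, ((e r : ℝ) - e u)) * X ^ (e r)
        + C (c s * ∏ u ∈ (((univ.erase p).erase q).erase r).erase s, ((e s : ℝ) - e u)) * X ^ (e s)).roots.toFinset.filter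
          (fun x => 0 < x)).card := by
  have hpq' : p ≠ q := hpq.ne
  have hqr' : q ≠ r := hqr.ne
  have hrs' : r ≠ s := hrs.ne
  have hpr' : p ≠ r := (hpq.trans hqr).ne
  have hps' : p ≠ s := (hpq.trans (hqr.trans hrs)).ne
  have hqs' : q ≠ s := (hqr.trans hrs).ne
  set U : Finset (Fin n) := (((univ.erase p).erase q).erase r).erase s with hU
  have hmemU : ∀ t, t ∈ U ↔ (t ≠ p ∧ t ≠ q ∧ t ≠ r ∧ t ≠ s) := by
    intro t; simp only [hU, Finset.mem_erase, Finset.mem_univ, and_true]; tauto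
  have hcardU : U.card + 4 = n := by
    have m1 : p ∈ (univ : Finset (Fin n)) := Finset.mem_univ _
    have m2 : q ∈ univ.erase p := by simp [hpq'.symm]
    have m3 : r ∈ (univ.erase p).erase q := by simp [hqr'.symm, hpr'.symm]
    have m4 : s ∈ ((univ.erase p).erase q).erase r := by simp [hrs'.symm, hps'.symm, hqs'.symm]
    have h4 : 4 ≤ n := by
      have := s.isLt; have := Fin.lt_def.mp hpq; have := Fin.lt_def.mp hqr; have := Fin.lt_def.mp hrs; omega
    rw [hU, Finset.card_erase_of_mem m4, Finset.card_erase_of_mem m3, Finset.card_erase_of_mem m2,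
      Finset.card_erase_of_mem m1, Finset.card_univ, Fintype.card_fin]
    omega
  have h1 := card_posRoots_le_card_posRoots_twists e c U
  have hzero : ∀ t ∈ U, c t * ∏ u ∈ U, ((e t : ℝ) - e u) = 0 := fun t ht => by
    rw [Finset.prod_eq_zero ht (sub_self _), mul_zero]
  have hfour : (∑ t, C (c t * ∏ u ∈ U, ((e t : ℝ) - e u)) * X ^ (e t))
      = C (c p * ∏ u ∈ U, ((e p : ℝ) - e u)) * X ^ (e p)
        + C (c q * ∏ u ∈ U, ((e q : ℝ) - e u)) * X ^ (e q)
        + C (c r * ∏ u ∈ U, ((e r : ℝ) - e u)) * X ^ (e r)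
        + C (c s * ∏ u ∈ U, ((e s : ℝ) - e u)) * X ^ (e s) := by
    rw [← Finset.sum_subset (Finset.subset_univ ({p, q, r, s} : Finset (Fin n)))]
    · rw [Finset.sum_insert (by simp [hpq', hpr', hps']), Finset.sum_insert (by simp [hqr', hqs']),
        Finset.sum_insert (by simp [hrs']), Finset.sum_singleton]
      ring
    · intro t _ ht
      have htU : t ∈ U := (hmemU t).mpr (by simpa [not_or] using ht)
      rw [hzero t htU, map_zero, zero_mul]
  rw [hfour] at h1
  omega

/-! ## The upper staircase in product form -/

/-- **UPPER STAIRCASE, PRODUCT FORM.**  Let `0 < a < b < c`, `A_p, A_q, A_r, A_s > 0`, and suppose the four-term polynomial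
`A_p X^i − A_q X^{i+a} + A_r X^{i+b} − A_s X^{i+c}` has at least three distinct positive roots.  Let `(β′, γ′, ξ)` be an upper-branch
double-root point of the normalised family (`ξ > 0`, `1 − β′ξ^a + γ′ξ^b − ξ^c = 0`, `−a + (b−a)γ′ξ^b − (c−a)ξ^c = 0`,
`b(b−a)γ′ξ^b ≤ c(c−a)ξ^c` — three rational checks at a rational `ξ`).  If the window's `γ` is at most `γ′`, in product form
`A_r^c ≤ γ′^c · A_p^{c−b} · A_s^b`, then its `β` is at most `β′`: `A_q^c ≤ β′^c · A_p^{c−a} · A_s^a`. [this work] -/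
theorem tetranomial_upper_staircase_coeff {a b c : ℕ} (ha : 0 < a) (hab : a < b) (hbc : b < c)
    (Ap Aq Ar As : ℝ) (hAp : 0 < Ap) (hAq : 0 < Aq) (hAr : 0 < Ar) (hAs : 0 < As) (i : ℕ)
    (hZ : 3 ≤ ((C Ap * X ^ i - C Aq * X ^ (i + a) + C Ar * X ^ (i + b) - C As * X ^ (i + c) : ℝ[X]).roots.toFinset.filter
      (fun x => 0 < x)).card)
    (β' γ' ξ : ℝ) (hξ : 0 < ξ)
    (hD₁ : (C 1 - C β' * X ^ a + C γ' * X ^ b - X ^ c : ℝ[X]).eval ξ = 0)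
    (hD₂ : (C (-(a : ℝ)) + C (((b : ℝ) - a) * γ') * X ^ b - C ((c : ℝ) - a) * X ^ c : ℝ[X]).eval ξ = 0)
    (hD₃ : (b : ℝ) * ((b : ℝ) - a) * γ' * ξ ^ b ≤ (c : ℝ) * ((c : ℝ) - a) * ξ ^ c)
    (hγ : Ar ^ c ≤ γ' ^ c * Ap ^ (c - b) * As ^ b) :
    Aq ^ c ≤ β' ^ c * Ap ^ (c - a) * As ^ a := by
  classical
  have hb : 0 < b := ha.trans hab
  have hc : 0 < c := hb.trans hbc
  have hc0 : c ≠ 0 := hc.ne'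
  -- γ' > 0 from the twist condition: (b−a)γ'ξ^b = a + (c−a)ξ^c > 0
  have hγ'pos : 0 < γ' := by
    rw [eval_twi] at hD₂
    have hba : (0 : ℝ) < (b : ℝ) - a := by
      have : (a : ℝ) < b := by exact_mod_cast hab
      linarith
    have hca : (0 : ℝ) < (c : ℝ) - a := by
      have : (a : ℝ) < c := by exact_mod_cast (hab.trans hbc)
      linarith
    have ha' : (0 : ℝ) < a := by exact_mod_cast ha
    have hξb : 0 < ξ ^ b := pow_pos hξ _
    have hξc : 0 < ξ ^ c := pow_pos hξ _
    by_contra hcon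
    push Not at hcon
    have : ((b : ℝ) - a) * γ' * ξ ^ b ≤ 0 :=
      mul_nonpos_of_nonpos_of_nonneg (mul_nonpos_of_nonneg_of_nonpos hba.le hcon) hξb.le
    nlinarith [mul_pos hca hξc]
  -- the scaling λ with λ^c = Ap / As
  set lam : ℝ := (Ap / As) ^ ((c : ℝ)⁻¹) with hlam
  have hq0 : 0 < Ap / As := div_pos hAp hAs
  have hlam0 : 0 < lam := Real.rpow_pos_of_pos hq0 _
  have hlamc : lam ^ c = Ap / As := by
    rw [hlam]; exact Real.rpow_inv_natCast_pow hq0.le hc0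
  set β : ℝ := Aq / Ap * lam ^ a with hβ
  set γ : ℝ := Ar / Ap * lam ^ b with hγdef
  have hβ0 : 0 < β := mul_pos (div_pos hAq hAp) (pow_pos hlam0 _)
  have hγ0 : 0 < γ := mul_pos (div_pos hAr hAp) (pow_pos hlam0 _)
  -- the normalised tetranomial vanishes at x/λ whenever the window vanishes at x > 0
  set D : ℝ[X] := C Ap * X ^ i - C Aq * X ^ (i + a) + C Ar * X ^ (i + b) - C As * X ^ (i + c) with hDdef
  set T : ℝ[X] := C 1 - C β * X ^ a + C γ * X ^ b - X ^ c with hTdef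
  have hroot : ∀ x : ℝ, 0 < x → D.eval x = 0 → T.eval (x / lam) = 0 := by
    intro x hx hDx
    have hDx' : Ap * x ^ i - Aq * x ^ (i + a) + Ar * x ^ (i + b) - As * x ^ (i + c) = 0 := by
      rw [hDdef] at hDx; simpa using hDx
    rw [hTdef, eval_tet, div_pow, div_pow, div_pow, hlamc, hβ, hγdef]
    have hxi : 0 < x ^ i := pow_pos hx _
    have hlama : lam ^ a ≠ 0 := (pow_pos hlam0 _).ne'
    have hlamb : lam ^ b ≠ 0 := (pow_pos hlam0 _).ne'
    have key : Ap * (1 - Aq / Ap * lam ^ a * (x ^ a / lam ^ a) + Ar / Ap * lam ^ b * (x ^ b / lam ^ b)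
        - x ^ c / (Ap / As)) * x ^ i
        = Ap * x ^ i - Aq * x ^ (i + a) + Ar * x ^ (i + b) - As * x ^ (i + c) := by
      field_simp
      ring
    have h2 : Ap * (1 - Aq / Ap * lam ^ a * (x ^ a / lam ^ a) + Ar / Ap * lam ^ b * (x ^ b / lam ^ b)
        - x ^ c / (Ap / As)) * x ^ i = 0 := by rw [key, hDx']
    rcases mul_eq_zero.mp h2 with h3 | h3
    · rcases mul_eq_zero.mp h3 with h4 | h4
      · exact absurd h4 hAp.ne'
      · exact h4
    · exact absurd h3 hxi.ne'
  -- hence the normalised tetranomial has ≥ 3 distinct positive roots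
  have hD0 : D ≠ 0 := by
    intro h0
    rw [h0, roots_zero, Multiset.toFinset_zero, Finset.filter_empty, Finset.card_empty] at hZ
    omega
  have hT0 : T ≠ 0 := by
    intro h0
    have : T.eval 0 = 0 := by rw [h0, eval_zero]
    rw [hTdef, eval_tet, zero_pow ha.ne', zero_pow hb.ne', zero_pow hc0] at this
    norm_num at this
  have hZT : 3 ≤ (T.roots.toFinset.filter (fun x => 0 < x)).card := by
    have hmap : ∀ x ∈ D.roots.toFinset.filter (fun x => 0 < x), x / lam ∈ T.roots.toFinset.filter (fun x => 0 < x) := by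
      intro x hx
      rw [Finset.mem_filter, Multiset.mem_toFinset, mem_roots hD0, IsRoot.def] at hx
      rw [Finset.mem_filter, Multiset.mem_toFinset, mem_roots hT0, IsRoot.def]
      exact ⟨hroot x hx.2 hx.1, div_pos hx.2 hlam0⟩
    calc 3 ≤ (D.roots.toFinset.filter (fun x => 0 < x)).card := hZ
      _ ≤ (T.roots.toFinset.filter (fun x => 0 < x)).card :=
          Finset.card_le_card_of_injOn (fun x => x / lam) hmap (fun x _ y _ h => by
            simpa [div_left_inj' hlam0.ne'] using h)
  -- γ ≤ γ' in the normalised coordinates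
  have hγle : γ ≤ γ' := by
    have hγc : γ ^ c = Ar ^ c / (Ap ^ (c - b) * As ^ b) := by
      rw [hγdef, mul_pow, div_pow, ← pow_mul, mul_comm b c, pow_mul, hlamc, div_pow]
      have hApc : Ap ^ c = Ap ^ (c - b) * Ap ^ b := by rw [← pow_add, Nat.sub_add_cancel hbc.le]
      rw [hApc]
      field_simp
    have hden : 0 < Ap ^ (c - b) * As ^ b := mul_pos (pow_pos hAp _) (pow_pos hAs _)
    have h1 : γ ^ c ≤ γ' ^ c := by
      rw [hγc, div_le_iff₀ hden]
      calc Ar ^ c ≤ γ' ^ c * Ap ^ (c - b) * As ^ b := hγ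
        _ = γ' ^ c * (Ap ^ (c - b) * As ^ b) := by ring
    exact (pow_le_pow_iff_left₀ hγ0.le hγ'pos.le hc0).mp h1
  -- the staircase lemma in normalised coordinates
  have hβle : β ≤ β' :=
    tetranomial_upper_staircase_of_card ha hab hbc β γ β' γ' ξ hZT hγle hξ hD₁ hD₂ hD₃
  -- back to product form
  have hβ'0 : 0 ≤ β' := hβ0.le.trans hβle
  have h2 : β ^ c ≤ β' ^ c := pow_le_pow_left₀ hβ0.le hβle c
  have hβc : β ^ c = Aq ^ c / (Ap ^ (c - a) * As ^ a) := by
    rw [hβ, mul_pow, div_pow, ← pow_mul, mul_comm a c, pow_mul, hlamc, div_pow]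
    have hApc : Ap ^ c = Ap ^ (c - a) * Ap ^ a := by rw [← pow_add, Nat.sub_add_cancel (hab.trans hbc).le]
    rw [hApc]
    field_simp
  have hden : 0 < Ap ^ (c - a) * As ^ a := mul_pos (pow_pos hAp _) (pow_pos hAs _)
  rw [hβc, div_le_iff₀ hden] at h2
  calc Aq ^ c ≤ β' ^ c * (Ap ^ (c - a) * As ^ a) := h2
    _ = β' ^ c * Ap ^ (c - a) * As ^ a := by ring

end Summit.ValiantsHypothesis.ValiantsHypothesis.Theorems.LacunarySymmetroidMatrixDescartes.Census.T4
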